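import Literature.InformationTheory.Entanglement.PureStateNegativity
import HarnessLib

/-!
# `‖ρ₁ ⊗ ρ₂‖₁ = ‖ρ₁‖₁‖ρ₂‖₁`, the partial transpose commutes with tensor products, and the additivity of the
# logarithmic negativity `E_𝒩(ρ₁ ⊗ ρ₂) = E_𝒩(ρ₁) + E_𝒩(ρ₂)` (Vidal–Werner 2002, § II.A eq. (9))

Hodge foundations lane (`lit-hodgefound`, prover p24 gen 77; quantum-information series, sequel of `Negativity.lean` and
`PureStateNegativity.lean`).  THEOREMS ONLY: no definition, no named fact, net debt 0; the trace norm of a Hermitian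
`A` is spelled `Σ_i |λ_i(A)|`, the negativity `Σ_i λ_i(A)⁻`.

## Source, VERBATIM

G. Vidal, R. F. Werner, *Computable measure of entanglement*, Phys. Rev. A **65** (2002) 032314 [VidalWerner2002],
§ II.A (held `paper:arxiv-quant-ph_0102117`, chunk p0005): «Another remarkable property of `𝒩(ρ)` is the easy way in which
`𝒩(ρ₁ ⊗ ρ₂)` relates to the negativity of `ρ₁` and that of `ρ₂`. … For the entanglement measure proposed in this paper
we get additivity for free. We start from the identity `‖ρ₁ ⊗ ρ₂‖₁ = ‖ρ₁‖₁‖ρ₂‖₁`, which is best shown by using the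
definition of the trace norm via eigenvalues, and observe that partial transposition commutes with taking tensor
products. After taking logarithms, we find for the logarithmic negativity: `E_𝒩(ρ₁ ⊗ ρ₂) = E_𝒩(ρ₁) + E_𝒩(ρ₂)`. (9)»

## Dictionary and proof route (declared deviation)

* `ρ₁` acts on `ℂ^{m₁} ⊗ ℂ^{n₁}`, `ρ₂` on `ℂ^{m₂} ⊗ ℂ^{n₂}`; the product state, as a bipartite operator of
  `(A₁A₂) : (B₁B₂)`, is the re-indexing `Matrix.reindex e e (ρ₁ ⊗ₖ ρ₂)` along
  `e = Equiv.prodProdProdComm m₁ n₁ m₂ n₂ : (m₁ × n₁) × (m₂ × n₂) ≃ (m₁ × m₂) × (n₁ × n₂)`.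
* «best shown by using the definition of the trace norm via eigenvalues» would need the product structure of the
  spectrum of `X ⊗ Y`; instead `‖X ⊗ Y‖₁ = ‖X‖₁‖Y‖₁` is certified by the variational sandwich of `Negativity.lean`: the
  Jordan decompositions `X = P − Q`, `Y = P' − Q'` give `X ⊗ Y = (P⊗P' + Q⊗Q') − (P⊗Q' + Q⊗P')` and the upper bound
  `(Tr P + Tr Q)(Tr P' + Tr Q')`; the symmetries `S_X = Σ_i sgn λ_i(X) u_iu_i^*` (`S² = 𝟙`, `Tr(XS_X) = ‖X‖₁`) give the
  lower bound through `Tr(AS) ≤ ‖A‖₁` for every symmetry `S` (`re_trace_mul_le_sum_abs_eigenvalues`, from the dual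
  bound of `PureStateNegativity.lean` with `Π = ½(𝟙 − S)`).

## What is formalized (all PROVED)

* § 1 `re_trace_mul_le_sum_abs_eigenvalues` (`Tr(AS) ≤ ‖A‖₁` for `S = S^*`, `S² = 𝟙`), `exists_symmetry_trace_eq`
  (the sign symmetry attaining it).
* § 2 **`sum_abs_eigenvalues_kronecker`** (`‖X ⊗ Y‖₁ = ‖X‖₁‖Y‖₁` for Hermitian `X, Y`).
* § 3 (private: invariance of `𝒩`, `Σ|λ|` under re-indexing), **`ptA_reindex_kronecker`** («partial transposition commutes with taking tensor products»),
  **`sum_abs_eigenvalues_ptA_kronecker`** (`‖(ρ₁⊗ρ₂)^{T_A}‖₁ = ‖ρ₁^{T_A}‖₁‖ρ₂^{T_A}‖₁`), **eq. (9)**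
  `log_traceNorm_ptA_kronecker` (`E_𝒩` additive) and `sum_negPart_eigenvalues_ptA_kronecker`
  (`𝒩(ρ₁ ⊗ ρ₂) = 𝒩(ρ₁) + 𝒩(ρ₂) + 2𝒩(ρ₁)𝒩(ρ₂)` for states).

## Tree / Mathlib search (2026-08-31)

`rg "trace_kronecker|sum_abs_eigenvalues" Literature/InformationTheory/Entanglement` → `Negativity.lean` only (no product
law); `rg "singularValues.*kronecker" Literature/LinearAlgebra` → ∅.  REUSED: `Negativity.{exists_jordan_decomposition,
sum_abs_eigenvalues_le_trace_add_trace, sum_abs_eigenvalues_eq_trace_add_two_mul, sum_negPart_eigenvalues_le_trace,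
sum_abs_eigenvalues_ptA}`, `PureStateNegativity.neg_re_trace_mul_le_sum_negPart_eigenvalues`, `SepDecomp.
star_eigenvectorBasis_dotProduct`, `PPT.ptA_apply`, `PPTOverlap.trace_ptA`; Mathlib `trace_kronecker`, `mul_kronecker_mul`,
`PosSemidef.kronecker`, `PosSemidef.submatrix`, `Equiv.prodProdProdComm`.

presearch: «trace norm tensor product multiplicative negativity additivity logarithmic negativity» → [corpus: arxiv
quant-ph/0102117 § II.A eq. (9)]; galaxy `"logarithmic negativity|trace norm"` (pdf) → VW and reviews only.

## References

* [VidalWerner2002] § II.A, eq. (9) and the surrounding paragraph.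
-/

noncomputable section

open Matrix Finset
open scoped ComplexOrder Kronecker

namespace Literature.InformationTheory.Entanglement.NegativityTensorProduct

open Literature.InformationTheory.Entanglement.PPT (ptA ptA_apply)
open Literature.InformationTheory.Entanglement.PPTOverlap (trace_ptA)
open Literature.InformationTheory.Entanglement.SepDecomp (star_eigenvectorBasis_dotProduct)
open Literature.InformationTheory.Entanglement.Negativity (exists_jordan_decomposition
  sum_abs_eigenvalues_le_trace_add_trace sum_abs_eigenvalues_eq_trace_add_two_mul sum_negPart_eigenvalues_le_trace
  sum_abs_eigenvalues_ptA)
open Literature.InformationTheory.Entanglement.PureStateNegativity (neg_re_trace_mul_le_sum_negPart_eigenvalues)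

/-! ## § 1. Symmetries: `Tr(AS) ≤ ‖A‖₁`, with equality for the sign of `A` -/

section Symmetry

variable {k : Type*} [Fintype k] [DecidableEq k]

omit [DecidableEq k] in
/-- `⟨v|M|v⟩ = Tr(M |v⟩⟨v|)`. [folklore] -/
private theorem star_dotProduct_mulVec_eq_trace (M : Matrix k k ℂ) (v : k → ℂ) :
    star v ⬝ᵥ (M *ᵥ v) = (M * vecMulVec v (star v)).trace := by
  simp only [Matrix.trace, diag_apply, mul_apply, vecMulVec_apply, Pi.star_apply, dotProduct, mulVec, Finset.mul_sum]
  refine Finset.sum_congr rfl fun a _ => Finset.sum_congr rfl fun c _ => ?_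
  ring

/-- Completeness `Σ_k u_ku_k^* = 𝟙` of the eigenbasis. [folklore] -/
private theorem sum_vecMulVec_eigenvectorBasis {A : Matrix k k ℂ} (hA : A.IsHermitian) :
    ∑ i, vecMulVec (⇑(hA.eigenvectorBasis i)) (star ⇑(hA.eigenvectorBasis i)) = 1 := by
  have hU := Matrix.mem_unitaryGroup_iff.mp (hA.eigenvectorUnitary).2
  rw [← hU]
  ext a c
  rw [Matrix.sum_apply, Matrix.mul_apply]
  refine Finset.sum_congr rfl fun i _ => ?_
  rw [vecMulVec_apply, Pi.star_apply, Matrix.star_apply, hA.eigenvectorUnitary_apply, hA.eigenvectorUnitary_apply]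

/-- `Tr(A u_iu_i^*) = λ_i`. [folklore] -/
private theorem trace_mul_proj_eigenvectorBasis {A : Matrix k k ℂ} (hA : A.IsHermitian) (i : k) :
    (A * vecMulVec (⇑(hA.eigenvectorBasis i)) (star ⇑(hA.eigenvectorBasis i))).trace = ((hA.eigenvalues i : ℝ) : ℂ) := by
  rw [← star_dotProduct_mulVec_eq_trace, hA.mulVec_eigenvectorBasis i, dotProduct_smul,
    star_eigenvectorBasis_dotProduct hA i i, if_pos rfl, Complex.real_smul, mul_one]

/-- **`Tr(AS) ≤ ‖A‖₁` for every symmetry `S` (`S = S^*`, `S² = 𝟙`)** — the dual bound `−Tr(AΠ) ≤ 𝒩(A)` at the projector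
`Π = ½(𝟙 − S)`, with `‖A‖₁ = Tr A + 2𝒩(A)`. [cite: VidalWerner2002, Lemma 2 (eq. (8)) with § II.A eq. (2)] -/
theorem re_trace_mul_le_sum_abs_eigenvalues {A S : Matrix k k ℂ} (hA : A.IsHermitian) (hS : S.IsHermitian)
    (hS2 : S * S = 1) : (A * S).trace.re ≤ ∑ i, |hA.eigenvalues i| := by
  set T : Matrix k k ℂ := ((1 / 2 : ℝ) : ℂ) • (1 - S) with hT
  set T' : Matrix k k ℂ := ((1 / 2 : ℝ) : ℂ) • (1 + S) with hT'
  have hTh : Tᴴ = T := by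
    rw [hT, conjTranspose_smul, conjTranspose_sub, conjTranspose_one, hS.eq, Complex.star_def, Complex.conj_ofReal]
  have hT'h : T'ᴴ = T' := by
    rw [hT', conjTranspose_smul, conjTranspose_add, conjTranspose_one, hS.eq, Complex.star_def, Complex.conj_ofReal]
  have hTT : T * T = T := by
    rw [hT, Matrix.smul_mul, Matrix.mul_smul, smul_smul, sub_mul, Matrix.mul_sub, Matrix.mul_sub, one_mul, mul_one,
      one_mul, hS2]
    push_cast
    module
  have hT'T' : T' * T' = T' := by
    rw [hT', Matrix.smul_mul, Matrix.mul_smul, smul_smul, add_mul, Matrix.mul_add, Matrix.mul_add, one_mul, mul_one,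
      one_mul, hS2]
    push_cast
    module
  have hTpsd : T.PosSemidef := by
    rw [show T = Tᴴ * T by rw [hTh, hTT]]; exact posSemidef_conjTranspose_mul_self T
  have h1T : (1 - T).PosSemidef := by
    have h1 : 1 - T = T' := by rw [hT, hT', smul_sub, smul_add]; push_cast; module
    rw [h1, show T' = T'ᴴ * T' by rw [hT'h, hT'T']]; exact posSemidef_conjTranspose_mul_self T'
  have h := neg_re_trace_mul_le_sum_negPart_eigenvalues hA hTpsd h1T
  have hS' : S = 1 - T - T := by rw [hT]; push_cast; module
  rw [sum_abs_eigenvalues_eq_trace_add_two_mul hA, hS', Matrix.mul_sub, Matrix.mul_sub, Matrix.mul_one, trace_sub,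
    trace_sub, Complex.sub_re, Complex.sub_re]
  linarith

/-- **The sign symmetry `S_A = Σ_i sgn(λ_i) u_iu_i^*`**: `S_A = S_A^*`, `S_A² = 𝟙`, `Tr(AS_A) = Σ_i|λ_i(A)| = ‖A‖₁`
(«the definition of the trace norm via eigenvalues»). [cite: VidalWerner2002, § II.A (before eq. (9))] -/
theorem exists_symmetry_trace_eq {A : Matrix k k ℂ} (hA : A.IsHermitian) :
    ∃ S : Matrix k k ℂ, S.IsHermitian ∧ S * S = 1 ∧ (A * S).trace = ((∑ i, |hA.eigenvalues i| : ℝ) : ℂ) := by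
  set s : k → ℝ := fun i => if 0 ≤ hA.eigenvalues i then 1 else -1 with hs
  have hs2 : ∀ i, s i * s i = 1 := fun i => by simp only [hs]; split_ifs <;> norm_num
  have hsabs : ∀ i, s i * hA.eigenvalues i = |hA.eigenvalues i| := fun i => by
    simp only [hs]
    split_ifs with h
    · rw [one_mul, abs_of_nonneg h]
    · rw [abs_of_neg (not_le.1 h)]; ring
  refine ⟨∑ i, ((s i : ℝ) : ℂ) • vecMulVec (⇑(hA.eigenvectorBasis i)) (star ⇑(hA.eigenvectorBasis i)), ?_, ?_, ?_⟩
  · -- Hermitian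
    change (∑ i, ((s i : ℝ) : ℂ) • vecMulVec (⇑(hA.eigenvectorBasis i)) (star ⇑(hA.eigenvectorBasis i)))ᴴ = _
    rw [conjTranspose_sum]
    refine Finset.sum_congr rfl fun i _ => ?_
    rw [conjTranspose_smul, conjTranspose_vecMulVec, star_star, Complex.star_def, Complex.conj_ofReal]
  · -- `S² = Σ_i s_i² u_iu_i^* = 𝟙`
    rw [Finset.sum_mul]
    have hterm : ∀ i, ((s i : ℝ) : ℂ) • vecMulVec (⇑(hA.eigenvectorBasis i)) (star ⇑(hA.eigenvectorBasis i)) *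
        ∑ j, ((s j : ℝ) : ℂ) • vecMulVec (⇑(hA.eigenvectorBasis j)) (star ⇑(hA.eigenvectorBasis j)) =
        vecMulVec (⇑(hA.eigenvectorBasis i)) (star ⇑(hA.eigenvectorBasis i)) := by
      intro i
      rw [Finset.mul_sum, Finset.sum_eq_single i]
      · rw [Matrix.smul_mul, Matrix.mul_smul, smul_smul, vecMulVec_mul_vecMulVec, star_eigenvectorBasis_dotProduct hA,
          if_pos rfl, one_smul, ← Complex.ofReal_mul, hs2, Complex.ofReal_one, one_smul]
      · intro j _ hj
        rw [Matrix.smul_mul, Matrix.mul_smul, vecMulVec_mul_vecMulVec, star_eigenvectorBasis_dotProduct hA,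
          if_neg (Ne.symm hj), zero_smul, vecMulVec_zero, smul_zero, smul_zero]
      · intro h; exact absurd (mem_univ i) h
    simp_rw [hterm]
    exact sum_vecMulVec_eigenvectorBasis hA
  · -- `Tr(AS) = Σ s_i λ_i = Σ|λ_i|`
    rw [Finset.mul_sum, trace_sum, Complex.ofReal_sum]
    refine Finset.sum_congr rfl fun i _ => ?_
    rw [Matrix.mul_smul, trace_smul, trace_mul_proj_eigenvectorBasis, smul_eq_mul, ← Complex.ofReal_mul, hsabs]

end Symmetry

/-! ## § 2. `‖X ⊗ Y‖₁ = ‖X‖₁ ‖Y‖₁` -/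

section KroneckerNorm

variable {p q : Type*} [Fintype p] [Fintype q] [DecidableEq p] [DecidableEq q]

omit [Fintype p] [Fintype q] [DecidableEq p] [DecidableEq q] in
/-- `(X ⊗ Y)^* = X^* ⊗ Y^*`, so Hermitian factors give a Hermitian product. [folklore] -/
private theorem isHermitian_kronecker {X : Matrix p p ℂ} {Y : Matrix q q ℂ} (hX : X.IsHermitian) (hY : Y.IsHermitian) :
    (X ⊗ₖ Y).IsHermitian := by
  change (X ⊗ₖ Y)ᴴ = X ⊗ₖ Y
  rw [conjTranspose_kronecker, hX.eq, hY.eq]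

omit [Fintype p] [Fintype q] [DecidableEq p] [DecidableEq q] in
/-- `(P − Q) ⊗ (P' − Q') = (P⊗P' + Q⊗Q') − (P⊗Q' + Q⊗P')`. [folklore] -/
private theorem sub_kronecker_sub (P Q : Matrix p p ℂ) (P' Q' : Matrix q q ℂ) :
    (P - Q) ⊗ₖ (P' - Q') = (P ⊗ₖ P' + Q ⊗ₖ Q') - (P ⊗ₖ Q' + Q ⊗ₖ P') := by
  ext ⟨a, b⟩ ⟨c, d⟩
  simp only [kroneckerMap_apply, Matrix.sub_apply, Matrix.add_apply]
  ring

omit [DecidableEq p] in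
/-- The trace of a positive semidefinite matrix is real. [folklore] -/
private theorem trace_eq_ofReal_re {P : Matrix p p ℂ} (hP : P.PosSemidef) : P.trace = ((P.trace.re : ℝ) : ℂ) := by
  obtain ⟨-, him⟩ := Complex.nonneg_iff.mp hP.trace_nonneg
  exact Complex.ext (by rw [Complex.ofReal_re]) (by rw [Complex.ofReal_im, ← him])

/-- **`‖X ⊗ Y‖₁ = ‖X‖₁‖Y‖₁` for Hermitian `X, Y`** («the identity `‖ρ₁ ⊗ ρ₂‖₁ = ‖ρ₁‖₁‖ρ₂‖₁`»): `≤` from the tensor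
products of the Jordan parts, `≥` from the symmetry `S_X ⊗ S_Y`. [cite: VidalWerner2002, § II.A (before eq. (9))] -/
theorem sum_abs_eigenvalues_kronecker {X : Matrix p p ℂ} {Y : Matrix q q ℂ} (hX : X.IsHermitian) (hY : Y.IsHermitian)
    (hXY : (X ⊗ₖ Y).IsHermitian) :
    ∑ i, |hXY.eigenvalues i| = (∑ i, |hX.eigenvalues i|) * ∑ j, |hY.eigenvalues j| := by
  refine le_antisymm ?_ ?_
  · obtain ⟨P, Q, hP, hQ, hXeq, -, hPtr, hQtr⟩ := exists_jordan_decomposition hX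
    obtain ⟨P', Q', hP', hQ', hYeq, -, hP'tr, hQ'tr⟩ := exists_jordan_decomposition hY
    have hdec : X ⊗ₖ Y = (P ⊗ₖ P' + Q ⊗ₖ Q') - (P ⊗ₖ Q' + Q ⊗ₖ P') := by rw [hXeq, hYeq, sub_kronecker_sub]
    have hX1 : ∑ i, |hX.eigenvalues i| = P.trace.re + Q.trace.re := by
      rw [hPtr, hQtr, ← Finset.sum_add_distrib]
      exact Finset.sum_congr rfl fun i _ => (posPart_add_negPart _).symm
    have hY1 : ∑ j, |hY.eigenvalues j| = P'.trace.re + Q'.trace.re := by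
      rw [hP'tr, hQ'tr, ← Finset.sum_add_distrib]
      exact Finset.sum_congr rfl fun i _ => (posPart_add_negPart _).symm
    calc ∑ i, |hXY.eigenvalues i|
        ≤ (P ⊗ₖ P' + Q ⊗ₖ Q').trace.re + (P ⊗ₖ Q' + Q ⊗ₖ P').trace.re :=
          sum_abs_eigenvalues_le_trace_add_trace hXY ((hP.kronecker hP').add (hQ.kronecker hQ'))
            ((hP.kronecker hQ').add (hQ.kronecker hP')) hdec
      _ = (P.trace.re + Q.trace.re) * (P'.trace.re + Q'.trace.re) := by
          rw [trace_add, trace_add, trace_kronecker, trace_kronecker, trace_kronecker, trace_kronecker,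
            trace_eq_ofReal_re hP, trace_eq_ofReal_re hQ, trace_eq_ofReal_re hP', trace_eq_ofReal_re hQ']
          simp only [← Complex.ofReal_mul, ← Complex.ofReal_add, Complex.ofReal_re]
          ring
      _ = (∑ i, |hX.eigenvalues i|) * ∑ j, |hY.eigenvalues j| := by rw [hX1, hY1]
  · obtain ⟨S, hS, hS2, hStr⟩ := exists_symmetry_trace_eq hX
    obtain ⟨S', hS', hS'2, hS'tr⟩ := exists_symmetry_trace_eq hY
    have h := re_trace_mul_le_sum_abs_eigenvalues hXY (isHermitian_kronecker hS hS')
      (by rw [← mul_kronecker_mul, hS2, hS'2, one_kronecker_one])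
    rw [← mul_kronecker_mul, trace_kronecker, hStr, hS'tr, ← Complex.ofReal_mul, Complex.ofReal_re] at h
    exact h

end KroneckerNorm

/-! ## § 3. Re-indexing, «partial transposition commutes with taking tensor products», and eq. (9) -/

section Reindex

variable {p q : Type*} [Fintype p] [Fintype q] [DecidableEq p] [DecidableEq q]

omit [DecidableEq p] [DecidableEq q] in
/-- The trace is invariant under re-indexing along an equivalence. [folklore] -/
private theorem trace_submatrix_equiv (e : q ≃ p) (A : Matrix p p ℂ) : (A.submatrix e e).trace = A.trace := by
  simp only [Matrix.trace, diag_apply, submatrix_apply]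
  exact e.sum_comp (fun j => A j j)

omit [DecidableEq p] [DecidableEq q] in
/-- The trace is invariant under `Matrix.reindex`. [folklore] -/
private theorem trace_reindex (e : p ≃ q) (A : Matrix p p ℂ) : (Matrix.reindex e e A).trace = A.trace := by
  rw [reindex_apply, trace_submatrix_equiv]

/-- `𝒩` is invariant under re-indexing (a permutation of the basis). [folklore] -/
private theorem sum_negPart_eigenvalues_reindex (e : p ≃ q) {A : Matrix p p ℂ} (hA : A.IsHermitian)
    (hB : (Matrix.reindex e e A).IsHermitian) : ∑ j, (hB.eigenvalues j)⁻ = ∑ i, (hA.eigenvalues i)⁻ := by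
  refine le_antisymm ?_ ?_
  · obtain ⟨P, Q, hP, hQ, hAeq, -, -, hQtr⟩ := exists_jordan_decomposition hA
    have hdec : Matrix.reindex e e A = P.submatrix e.symm e.symm - Q.submatrix e.symm e.symm := by
      rw [hAeq, reindex_apply]
      rfl
    calc ∑ j, (hB.eigenvalues j)⁻ ≤ (Q.submatrix e.symm e.symm).trace.re :=
          sum_negPart_eigenvalues_le_trace hB (hP.submatrix e.symm) (hQ.submatrix e.symm) hdec
      _ = _ := by rw [trace_submatrix_equiv, hQtr]
  · obtain ⟨P, Q, hP, hQ, hBeq, -, -, hQtr⟩ := exists_jordan_decomposition hB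
    have hback : A = P.submatrix e e - Q.submatrix e e := by
      have hA' : A = (Matrix.reindex e e A).submatrix e e := by
        ext i j
        simp [reindex_apply, submatrix_apply]
      rw [hA', hBeq]
      rfl
    calc ∑ i, (hA.eigenvalues i)⁻ ≤ (Q.submatrix e e).trace.re :=
          sum_negPart_eigenvalues_le_trace hA (hP.submatrix e) (hQ.submatrix e) hback
      _ = _ := by rw [trace_submatrix_equiv, hQtr]

/-- … and so is the trace norm `Σ|λ_i|`. [folklore] -/
private theorem sum_abs_eigenvalues_reindex (e : p ≃ q) {A : Matrix p p ℂ} (hA : A.IsHermitian)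
    (hB : (Matrix.reindex e e A).IsHermitian) : ∑ j, |hB.eigenvalues j| = ∑ i, |hA.eigenvalues i| := by
  rw [sum_abs_eigenvalues_eq_trace_add_two_mul hB, sum_abs_eigenvalues_eq_trace_add_two_mul hA, trace_reindex,
    sum_negPart_eigenvalues_reindex e hA hB]

end Reindex

section Tensor

variable {m₁ n₁ m₂ n₂ : Type*} [Fintype m₁] [Fintype n₁] [Fintype m₂] [Fintype n₂]
  [DecidableEq m₁] [DecidableEq n₁] [DecidableEq m₂] [DecidableEq n₂]

omit [Fintype m₁] [Fintype n₁] [Fintype m₂] [Fintype n₂] [DecidableEq m₁] [DecidableEq n₁] [DecidableEq m₂]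
  [DecidableEq n₂] in
/-- **«partial transposition commutes with taking tensor products»**: regrouping `ρ₁ ⊗ ρ₂` as an operator on
`(ℂ^{m₁} ⊗ ℂ^{m₂}) ⊗ (ℂ^{n₁} ⊗ ℂ^{n₂})`, its partial transpose on the first (`A₁A₂`) factor is the regrouping of
`ρ₁^{T_A} ⊗ ρ₂^{T_A}`. [cite: VidalWerner2002, § II.A (before eq. (9))] -/
theorem ptA_reindex_kronecker (ρ₁ : Matrix (m₁ × n₁) (m₁ × n₁) ℂ) (ρ₂ : Matrix (m₂ × n₂) (m₂ × n₂) ℂ) :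
    ptA (Matrix.reindex (Equiv.prodProdProdComm m₁ n₁ m₂ n₂) (Equiv.prodProdProdComm m₁ n₁ m₂ n₂) (ρ₁ ⊗ₖ ρ₂)) =
      Matrix.reindex (Equiv.prodProdProdComm m₁ n₁ m₂ n₂) (Equiv.prodProdProdComm m₁ n₁ m₂ n₂) (ptA ρ₁ ⊗ₖ ptA ρ₂) := by
  ext ⟨⟨a₁, a₂⟩, ⟨b₁, b₂⟩⟩ ⟨⟨c₁, c₂⟩, ⟨d₁, d₂⟩⟩
  simp only [ptA_apply, reindex_apply, submatrix_apply, kroneckerMap_apply, Equiv.prodProdProdComm_symm,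
    Equiv.prodProdProdComm_apply]

omit [DecidableEq m₁] [DecidableEq n₁] [DecidableEq m₂] [DecidableEq n₂] in
/-- The regrouped product of two states has unit trace. [folklore] -/
private theorem trace_reindex_kronecker {ρ₁ : Matrix (m₁ × n₁) (m₁ × n₁) ℂ} {ρ₂ : Matrix (m₂ × n₂) (m₂ × n₂) ℂ}
    (h1 : ρ₁.trace = 1) (h2 : ρ₂.trace = 1) :
    (Matrix.reindex (Equiv.prodProdProdComm m₁ n₁ m₂ n₂) (Equiv.prodProdProdComm m₁ n₁ m₂ n₂) (ρ₁ ⊗ₖ ρ₂)).trace = 1 := by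
  rw [trace_reindex, trace_kronecker, h1, h2, mul_one]

/-- Transport of `Σ|λ|` along an equality of matrices. [folklore] -/
private theorem sum_abs_eigenvalues_congr {k : Type*} [Fintype k] [DecidableEq k] {X Y : Matrix k k ℂ}
    (hX : X.IsHermitian) (hY : Y.IsHermitian) (h : X = Y) : ∑ i, |hX.eigenvalues i| = ∑ i, |hY.eigenvalues i| := by
  subst h; rfl

/-- **`‖(ρ₁ ⊗ ρ₂)^{T_A}‖₁ = ‖ρ₁^{T_A}‖₁ · ‖ρ₂^{T_A}‖₁`** (any operators `ρ₁, ρ₂`; Hermitian-ness witnesses of the three partial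
transposes). [cite: VidalWerner2002, § II.A (before eq. (9))] -/
theorem sum_abs_eigenvalues_ptA_kronecker {ρ₁ : Matrix (m₁ × n₁) (m₁ × n₁) ℂ} {ρ₂ : Matrix (m₂ × n₂) (m₂ × n₂) ℂ}
    (h1 : (ptA ρ₁).IsHermitian) (h2 : (ptA ρ₂).IsHermitian)
    (h12 : (ptA (Matrix.reindex (Equiv.prodProdProdComm m₁ n₁ m₂ n₂) (Equiv.prodProdProdComm m₁ n₁ m₂ n₂)
      (ρ₁ ⊗ₖ ρ₂))).IsHermitian) :
    ∑ i, |h12.eigenvalues i| = (∑ i, |h1.eigenvalues i|) * ∑ j, |h2.eigenvalues j| := by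
  have hK : (ptA ρ₁ ⊗ₖ ptA ρ₂).IsHermitian := isHermitian_kronecker h1 h2
  have hKr : (Matrix.reindex (Equiv.prodProdProdComm m₁ n₁ m₂ n₂) (Equiv.prodProdProdComm m₁ n₁ m₂ n₂)
      (ptA ρ₁ ⊗ₖ ptA ρ₂)).IsHermitian := by rw [← ptA_reindex_kronecker]; exact h12
  rw [sum_abs_eigenvalues_congr h12 hKr (ptA_reindex_kronecker ρ₁ ρ₂), sum_abs_eigenvalues_reindex _ hK hKr,
    sum_abs_eigenvalues_kronecker h1 h2 hK]

/-- **Eq. (9), additivity of the logarithmic negativity: `log‖(ρ₁⊗ρ₂)^{T_A}‖₁ = log‖ρ₁^{T_A}‖₁ + log‖ρ₂^{T_A}‖₁`** for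
states `ρ₁, ρ₂` (unit trace, so that `‖ρ_i^{T_A}‖₁ = 1 + 2𝒩 ≥ 1`). [cite: VidalWerner2002, § II.A eq. (9)] -/
theorem log_traceNorm_ptA_kronecker {ρ₁ : Matrix (m₁ × n₁) (m₁ × n₁) ℂ} {ρ₂ : Matrix (m₂ × n₂) (m₂ × n₂) ℂ}
    (hρ₁ : ρ₁.trace = 1) (hρ₂ : ρ₂.trace = 1) (h1 : (ptA ρ₁).IsHermitian) (h2 : (ptA ρ₂).IsHermitian)
    (h12 : (ptA (Matrix.reindex (Equiv.prodProdProdComm m₁ n₁ m₂ n₂) (Equiv.prodProdProdComm m₁ n₁ m₂ n₂)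
      (ρ₁ ⊗ₖ ρ₂))).IsHermitian) :
    Real.log (∑ i, |h12.eigenvalues i|) = Real.log (∑ i, |h1.eigenvalues i|) + Real.log (∑ j, |h2.eigenvalues j|) := by
  rw [sum_abs_eigenvalues_ptA_kronecker h1 h2 h12]
  have hpos1 : 0 < ∑ i, |h1.eigenvalues i| := by
    rw [sum_abs_eigenvalues_ptA hρ₁ h1]
    have := Finset.sum_nonneg fun i (_ : i ∈ univ) => negPart_nonneg (h1.eigenvalues i)
    linarith
  have hpos2 : 0 < ∑ j, |h2.eigenvalues j| := by
    rw [sum_abs_eigenvalues_ptA hρ₂ h2]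
    have := Finset.sum_nonneg fun i (_ : i ∈ univ) => negPart_nonneg (h2.eigenvalues i)
    linarith
  exact Real.log_mul hpos1.ne' hpos2.ne'

/-- **«`𝒩(ρ₁ ⊗ ρ₂)` relates to the negativity of `ρ₁` and that of `ρ₂`»: `𝒩(ρ₁ ⊗ ρ₂) = 𝒩(ρ₁) + 𝒩(ρ₂) + 2𝒩(ρ₁)𝒩(ρ₂)`**
for states (`1 + 2𝒩(ρ₁ ⊗ ρ₂) = (1 + 2𝒩(ρ₁))(1 + 2𝒩(ρ₂))`). [cite: VidalWerner2002, § II.A (eq. (2) with the identity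
before eq. (9))] -/
theorem sum_negPart_eigenvalues_ptA_kronecker {ρ₁ : Matrix (m₁ × n₁) (m₁ × n₁) ℂ}
    {ρ₂ : Matrix (m₂ × n₂) (m₂ × n₂) ℂ} (hρ₁ : ρ₁.trace = 1) (hρ₂ : ρ₂.trace = 1) (h1 : (ptA ρ₁).IsHermitian)
    (h2 : (ptA ρ₂).IsHermitian)
    (h12 : (ptA (Matrix.reindex (Equiv.prodProdProdComm m₁ n₁ m₂ n₂) (Equiv.prodProdProdComm m₁ n₁ m₂ n₂)
      (ρ₁ ⊗ₖ ρ₂))).IsHermitian) :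
    ∑ i, (h12.eigenvalues i)⁻ =
      ∑ i, (h1.eigenvalues i)⁻ + ∑ j, (h2.eigenvalues j)⁻ + 2 * ((∑ i, (h1.eigenvalues i)⁻) * ∑ j, (h2.eigenvalues j)⁻) := by
  have h := sum_abs_eigenvalues_ptA_kronecker h1 h2 h12
  rw [sum_abs_eigenvalues_ptA hρ₁ h1, sum_abs_eigenvalues_ptA hρ₂ h2,
    sum_abs_eigenvalues_ptA (trace_reindex_kronecker hρ₁ hρ₂) h12] at h
  linear_combination h / 2

end Tensor

end Literature.InformationTheory.Entanglement.NegativityTensorProduct
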